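import Summits.CriticalPhenomena.PercolationContinuityZ3.Theorems.PercExchangeRateTransportCriticalCurveRegular

/-!
# Witness of weakness (F3 / BC5) for the rung family `CriticalLocusContinuous T` — line `isotropic_locus_continuity`
# (crux K⁺ `SupercritExchangeUniformity`, stmt-CriticalPhenomena-16061; route `PercExchangeRateTransport`)

`CriticalLocusContinuous ∅` IS the floor: it follows from the seed theorem
`Cruxes.CriticalCurveRegular.Locmod.CriticalCurveRegular_proof` (item stmt-CriticalPhenomena-16065:
`ContinuousOn p_c (0,1) ∧ ∀ t ∈ (0,1), 0 < p_c(t) < 1` for the label-coupled anisotropic bond family on `ℤ²×ℤ`)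
alone — the second conjunct (continuity of the critical density `J(t) = θ(p_c(t),t)` at every level of `T`)
is vacuous at `T = ∅`.  The rung is `T = {p_c(ℤ³)}` (`IsotropicLocusContinuity`), which the seed's proof
cannot give: its one-sided Aizenman–Grimmett shear compares `θ` across levels only up to the constant
`C = μ₀^{-N} 2^N N` in the `p`-shift, so at a curve point it bounds `J(t)` by a SUPERCRITICAL value
`θ(p_c(s)⁺ + O(t−s), s)` at the other level, never by `J(s)`.
witness_regime: anisotropic `ℤ²×ℤ` bond family, `t ∈ (0,1)`; `θ(p_c) = 0` is NOT known anywhere on it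
(at `t = p₃` it is the sub-problem statement itself).
Self-contained copy of the family (verbatim the `def`s of `Lines/isotropic_locus_continuity.lean`, separate
namespace so both files coexist in the build).
-/

namespace Summit.CriticalPhenomena.PercolationContinuityZ3.Cruxes.SupercritExchangeUniformity.IsoLocus.Special

open Summit.CriticalPhenomena.PercolationContinuityZ3.Theses.PercExchangeRateTransport

/-- Verbatim copy of `IsoLocus.CriticalLocusContinuous` (self-contained witness file). -/
def CriticalLocusContinuous (T : Set ℝ) : Prop :=
  let μ := Literature.Probability.Percolation.labelMeasure (Literature.Probability.LatticeModels.Site 3); let vert : Sym2 (Literature.Probability.LatticeModels.Site 3) → Prop := fun e => ∃ x : Literature.Probability.LatticeModels.Site 3, e = s(x, x + Pi.single (2 : Fin 3) 1); let cfg : ℝ → ℝ → (Sym2 (Literature.Probability.LatticeModels.Site 3) → ℝ) → Set (Sym2 (Literature.Probability.LatticeModels.Site 3)) := fun p t U => {e | e ∈ (Literature.Probability.LatticeModels.zdGraph 3).edgeSet ∧ ((vert e ∧ U e ≤ t) ∨ (¬ vert e ∧ U e ≤ p))}; let θ : ℝ → ℝ → ℝ := fun p t => μ.real {U | cfg p t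 U ∈ Literature.Probability.Percolation.percolatesAt (0 : Literature.Probability.LatticeModels.Site 3)}; let pc : ℝ → ℝ := fun t => sInf ({p : ℝ | 0 ≤ p ∧ p ≤ 1 ∧ 0 < θ p t} ∪ {1}); (ContinuousOn pc (Set.Ioo 0 1) ∧ ∀ t ∈ Set.Ioo (0 : ℝ) 1, 0 < pc t ∧ pc t < 1) ∧ ∀ t₀ ∈ T, t₀ ∈ Set.Ioo (0 : ℝ) 1 → ContinuousWithinAt (fun t => θ (pc t) t) (Set.Ioo 0 1) t₀

/-- Verbatim copy of `IsoLocus.IsotropicLocusContinuity`: the rung, `T = {p_c(ℤ³)}`. -/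
def IsotropicLocusContinuity : Prop :=
  CriticalLocusContinuous {Literature.Probability.Percolation.criticalProb (Literature.Probability.LatticeModels.zdGraph 3) (0 : Literature.Probability.LatticeModels.Site 3)}

/-- **F3 witness: the floor is the `T = ∅` instance of the family**, by `simpa` from the seed. -/
example : CriticalLocusContinuous ∅ := by
  simpa [CriticalLocusContinuous, CriticalCurveRegular] using
    Summit.CriticalPhenomena.PercolationContinuityZ3.Cruxes.CriticalCurveRegular.Locmod.CriticalCurveRegular_proof

/-- The same as a named theorem with a two-line term. -/
theorem criticalLocusContinuous_floor : CriticalLocusContinuous ∅ := by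
  unfold CriticalLocusContinuous
  exact ⟨Summit.CriticalPhenomena.PercolationContinuityZ3.Cruxes.CriticalCurveRegular.Locmod.CriticalCurveRegular_proof,
    fun t ht _ => (Set.notMem_empty t ht).elim⟩

/-- … and the floor is literally the `T = ∅` member (both directions). -/
theorem criticalLocusContinuous_empty_iff : CriticalLocusContinuous ∅ ↔ CriticalCurveRegular := by
  unfold CriticalLocusContinuous CriticalCurveRegular
  exact ⟨fun h => h.1, fun h => ⟨h, fun t ht _ => (Set.notMem_empty t ht).elim⟩⟩

/-- The family is antitone in `T`; in particular the rung hands back the floor. -/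
theorem criticalLocusContinuous_mono {T T' : Set ℝ} (h : T ⊆ T') :
    CriticalLocusContinuous T' → CriticalLocusContinuous T := by
  unfold CriticalLocusContinuous
  intro h'
  exact ⟨h'.1, fun t ht => h'.2 t (h ht)⟩

theorem floor_of_rung : IsotropicLocusContinuity → CriticalCurveRegular := fun h =>
  criticalLocusContinuous_empty_iff.1 (criticalLocusContinuous_mono (Set.empty_subset _) h)

end Summit.CriticalPhenomena.PercolationContinuityZ3.Cruxes.SupercritExchangeUniformity.IsoLocus.Special
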